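import Summits.BirchSwinnertonDyer.BirchSwinnertonDyer.Theorems.GoldfeldAllTwistsTwoConverseTwinOddTwoPrimesTwistSelmerDualPOne
import Summits.BirchSwinnertonDyer.BirchSwinnertonDyer.Theorems.GoldfeldAllTwistsTwoConverseTwinSplitSymbolAlphaRoots
import Mathlib.NumberTheory.LegendreSymbol.QuadraticChar.Basic
import Mathlib.FieldTheory.Finite.Basic
import HarnessLib

set_option linter.dupNamespace false -- namespace `…BirchSwinnertonDyer.BirchSwinnertonDyer…` is the cell's (D-0017 nested layout)
set_option autoImplicit false

/-!
# OBJECT A7⁺, tranche T1, file D⁺-9: the dual Selmer set `S′ = S(42qp, −7q²p²) ⊆ {1, −7, −q, 7q}` of `A^{(−qp)} = 49a1^{(−qp)}` on a75+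
# (`q ≡ 7 (8)`, `(q/7) = −1`; `p ≡ 5 (8)`, `(−7/p) = 1`, type α; `(p/q) = +1`) — D⁺-4's twin with the type-α root test AT `p ≡ 5 (mod 8)` (FACT-FREE)

Cell `bsd-goldfeld`, seat `bsd-goldfeld-s1p-c3x` (gen 15); planner RULING (ccclxxxii) ORDER «OBJECT A7⁺ BY THE χ_Z CHANNEL», tranche T1
(memo `HOME/PLUS-CHIZ-CHANNEL.md` §2 D⁺). `--supports stmt-BirchSwinnertonDyer-20044` as a HELPER. Theses-free; theorems only; no definition,
no fact binder, no `sorry`. FRONTIER-grade: a twist-density-ZERO sub-family; never distance-to-summit.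

`S′ = S(42qp, −7q²p²)`: `{−1, q, −p, qp}` and `{7, −7q, 7p, −7qp}` die at `7` (X0 a1's `not_isSoluble_seven_odd(')`, VERBATIM); on a75+ `(q/p) = +1`, so
`−q, 7q` SURVIVE and the whole `p`-coset `{p, −7p, −qp, 7qp}` dies AT `p` by the type-α root test of `Q₅ = 7X⁴ + 42X² − 1`, `Q₆ = X⁴ − 42X² − 7` —
here at `p ≡ 5 (mod 8)` (§1 `rootfree_Q5_Q6_of_alpha_five`: a root gives `r` with `r² = 7` and `2r` a square; since `2 ∉ 𝔽_p^{×2}`, `r` is a non-square,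
and so is `i` (`i² = −1`, `p ≢ 1 (8)`), hence `ir` IS a square with `(ir)² = −7` — a fourth root of `−7`, contradicting type α). Hence
**`S′ ⊆ {1, −7, −q, 7q}`, `#S′ ≤ 4`** (sharp: seat's kill tables; kit j322778 56/56 a75+ rows `A^{(−qp)}` ellrank 1/1/0).
* §1 `oddTwoPrimes_facts_plusPFive`, `rootfree_Q5_Q6_of_alpha_five`, the four `p`-adic class kills; §2 the subset theorem and `#S′ ≤ 4`.
HONEST FRAMING: a Selmer-set count; nothing about `L`-values; items 19140 / 20044 unchanged; BSD is not proved by any of this.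

References: [SilvermanAEC2009] X.4.9–X.4.10; [Zywina2025] Lemma 3.1 (proof); [CoatesLiTianZhai2015] §5 (type α).
-/

noncomputable section

open scoped Classical

open Literature.NumberTheory.EllipticCurves

namespace Summit.BirchSwinnertonDyer.BirchSwinnertonDyer.Theorems.GoldfeldGoodTwists

section OddSelmerDualPlusPFive
variable {q p : ℕ} [Fact q.Prime] [Fact p.Prime]

/-- A natural number not divisible by the prime `ℓ` is non-zero in `ZMod ℓ`, as an integer cast. [folklore] -/
private theorem intCast_ne_zero_of_not_dvd_oddDualPlusFive {l : ℕ} [Fact l.Prime] {n : ℕ} (h : ¬ l ∣ n) : ((n : ℤ) : ZMod l) ≠ 0 := by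
  rw [Int.cast_natCast, Ne, ZMod.natCast_eq_zero_iff]; exact h

/-! ## §1 The symbols on a71+ and the `p`-adic kills of the `p`-coset -/

/-- The family's symbols and non-vanishings on a75+ (`q ≡ 7 (8)`, `(q/7) = −1`; `p ≡ 5 (8)`, `(−7/p) = 1`; `(p/q) = +1`): `q, p ∉ {2, 7}` distinct,
`7 ∤ qp`, `(q/7)_L = −1`, `(p/7)_L = 1`, `(2/p) = −1`, `(7/p) = (−1/p) = 1`, `(q/p) = +1`. [folklore] -/
theorem oddTwoPrimes_facts_plusPFive (hq8 : q % 8 = 7) (hq7 : jacobiSym q 7 = -1) (hp8 : p % 8 = 5) (hp7 : legendreSym p (-7) = 1)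
    (hpq : jacobiSym p q = 1) :
    (q ≠ 2 ∧ p ≠ 2 ∧ q ≠ p ∧ ¬ 7 ∣ q * p ∧ ¬ (7 : ℤ) ∣ q ∧ ¬ (7 : ℤ) ∣ p) ∧
    (legendreSym 7 q = -1 ∧ legendreSym 7 p = 1 ∧ ((q : ℤ) : ZMod 7) ≠ 0 ∧ ((p : ℤ) : ZMod 7) ≠ 0) ∧
    (legendreSym p 2 = -1 ∧ legendreSym p 7 = 1 ∧ legendreSym p (-1) = 1 ∧ legendreSym p q = 1) ∧
    (((q : ℤ) : ZMod p) ≠ 0 ∧ ((p : ℤ) : ZMod q) ≠ 0) := by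
  have hq : q.Prime := Fact.out
  have hp : p.Prime := Fact.out
  haveI : Fact (Nat.Prime 7) := ⟨by norm_num⟩
  have hq2 : q ≠ 2 := by rintro rfl; norm_num at hq8
  have hp2 : p ≠ 2 := by rintro rfl; norm_num at hp8
  have hqp : q ≠ p := by rintro rfl; omega
  have hq7' : q ≠ 7 := by rintro rfl; rw [jacobiSym.mod_left] at hq7; norm_num at hq7
  have hp7' : p ≠ 7 := by rintro rfl; norm_num at hp8
  have h7Q : ¬ (7 : ℤ) ∣ q := fun h ↦ hq7' ((Nat.prime_dvd_prime_iff_eq (by norm_num) hq).mp (by exact_mod_cast h)).symm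
  have h7P : ¬ (7 : ℤ) ∣ p := fun h ↦ hp7' ((Nat.prime_dvd_prime_iff_eq (by norm_num) hp).mp (by exact_mod_cast h)).symm
  have h7qp : ¬ 7 ∣ q * p := fun h ↦ ((Nat.Prime.dvd_mul (by norm_num)).mp h).elim (fun h ↦ h7Q (by exact_mod_cast h))
    (fun h ↦ h7P (by exact_mod_cast h))
  obtain ⟨h2p, h7p, hm1p⟩ := legendreSym_two_seven_neg_one_of_five_mod_eight hp8 hp7
  have hqp_p : legendreSym p q = 1 := by
    have h := legendreSym.quadratic_reciprocity_one_mod_four (by omega : p % 4 = 1) hq2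
    rw [← jacobiSym.legendreSym.to_jacobiSym] at hpq
    rw [← h]; exact hpq
  have h7_q : legendreSym 7 q = -1 := by rw [jacobiSym.legendreSym.to_jacobiSym]; exact_mod_cast hq7
  have h7_p : legendreSym 7 p = 1 := by
    rw [legendreSym.quadratic_reciprocity_one_mod_four (by omega : p % 4 = 1) (by norm_num : 7 ≠ 2)]; exact h7p
  have hq07 : ((q : ℤ) : ZMod 7) ≠ 0 := by rw [Ne, ZMod.intCast_zmod_eq_zero_iff_dvd]; exact_mod_cast h7Q
  have hp07 : ((p : ℤ) : ZMod 7) ≠ 0 := by rw [Ne, ZMod.intCast_zmod_eq_zero_iff_dvd]; exact_mod_cast h7P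
  have hqp0 : ((q : ℤ) : ZMod p) ≠ 0 :=
    intCast_ne_zero_of_not_dvd_oddDualPlusFive (l := p) (fun h ↦ hqp ((Nat.prime_dvd_prime_iff_eq hp hq).mp h).symm)
  have hpq0 : ((p : ℤ) : ZMod q) ≠ 0 :=
    intCast_ne_zero_of_not_dvd_oddDualPlusFive (l := q) (fun h ↦ hqp ((Nat.prime_dvd_prime_iff_eq hq hp).mp h))
  exact ⟨⟨hq2, hp2, hqp, h7qp, h7Q, h7P⟩, ⟨h7_q, h7_p, hq07, hp07⟩, ⟨h2p, h7p, hm1p, hqp_p⟩, ⟨hqp0, hpq0⟩⟩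

omit [Fact q.Prime] in
/-- **Type α at `p ≡ 5 (mod 8)`: `Q₅ = 7X⁴ + 42X² − 1` and `Q₆ = X⁴ − 42X² − 7` have no root mod `p`.** A root gives `r` with `r² = 7` and `2r ∈ 𝔽_p^{×2}`
(`Q₅`: `r = (7X² + 21)/8`, `2r = ((3 − 7X²)/(8X))²`; `Q₆`: `r = (X² − 21)/8 = 2·(8X/(X² + 3))²`); `2 ∉ 𝔽_p^{×2}` makes `r` a non-square, `i` (`i² = −1`) is a
non-square since `8 ∤ p − 1`, so `ir` is a square with `(ir)² = −7`: a fourth root of `−7`, against type α. [cite: CoatesLiTianZhai2015, §5 (type α)] -/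
theorem rootfree_Q5_Q6_of_alpha_five (hp8 : p % 8 = 5) (hp7 : legendreSym p (-7) = 1) (hα : ¬ ∃ x : ZMod p, x ^ 4 = -7) (X : ZMod p) :
    7 * X ^ 4 + 42 * X ^ 2 - 1 ≠ 0 ∧ X ^ 4 - 42 * X ^ 2 - 7 ≠ 0 := by
  have hp : p.Prime := Fact.out
  have hp2 : p ≠ 2 := by rintro rfl; norm_num at hp8
  obtain ⟨h2, -, hm1⟩ := legendreSym_two_seven_neg_one_of_five_mod_eight hp8 hp7
  have h2F : (2 : ZMod p) ≠ 0 := by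
    have : ((2 : ℕ) : ZMod p) ≠ 0 := by
      rw [Ne, ZMod.natCast_eq_zero_iff]; exact fun h ↦ hp2 ((Nat.prime_dvd_prime_iff_eq hp Nat.prime_two).mp h)
    exact_mod_cast this
  have h8 : (8 : ZMod p) ≠ 0 := by rw [show (8 : ZMod p) = 2 ^ 3 by norm_num]; exact pow_ne_zero 3 h2F
  have h7F : (7 : ZMod p) ≠ 0 := by
    have hp7' : p ≠ 7 := by rintro rfl; norm_num at hp8
    have : ((7 : ℕ) : ZMod p) ≠ 0 := by
      rw [Ne, ZMod.natCast_eq_zero_iff]; exact fun h ↦ hp7' ((Nat.prime_dvd_prime_iff_eq hp (by norm_num)).mp h)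
    exact_mod_cast this
  have hns2 : ¬ IsSquare (2 : ZMod p) := by
    have h := (legendreSym.eq_neg_one_iff p).mp h2; push_cast at h; exact h
  -- `i² = −1`, `i` a non-square (`p ≢ 1 (8)`)
  obtain ⟨i, hi⟩ : ∃ i : ZMod p, i ^ 2 = -1 := by
    obtain ⟨i, hi⟩ := ZMod.exists_sq_eq_neg_one_iff.mpr (by omega : p % 4 ≠ 3); exact ⟨i, by rw [sq]; exact hi.symm⟩
  have hnsi : ¬ IsSquare i := by
    rintro ⟨w, hw⟩
    have hw4 : w ^ (2 ^ 2) = -1 := by rw [show w ^ (2 ^ 2) = (w * w) ^ 2 by ring, ← hw, hi]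
    have hw8 : w ^ (2 ^ (2 + 1)) = 1 := by rw [show w ^ (2 ^ (2 + 1)) = (w ^ (2 ^ 2)) ^ 2 by ring, hw4]; norm_num
    have hm1 : (-1 : ZMod p) ≠ 1 := by
      intro h
      have h2' : (2 : ZMod p) = 0 := by linear_combination -h
      exact h2F h2'
    have hord : orderOf w = 2 ^ (2 + 1) := orderOf_eq_prime_pow (by rw [hw4]; exact hm1) hw8
    have hw0 : w ≠ 0 := by rintro rfl; norm_num at hw4
    have hdvd := ZMod.orderOf_dvd_card_sub_one hw0
    rw [hord] at hdvd
    norm_num at hdvd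
    omega
  -- the common step: `r² = 7`, `2r` a square ⟹ contradiction
  have key : ∀ r : ZMod p, r ^ 2 = 7 → IsSquare (2 * r) → False := by
    intro r hr h2r
    have hr0 : r ≠ 0 := by rintro rfl; rw [zero_pow two_ne_zero] at hr; exact h7F hr.symm
    have hnsr : ¬ IsSquare r := by
      rintro ⟨y, hy⟩
      obtain ⟨w, hw⟩ := h2r
      have hy0 : y ≠ 0 := by rintro rfl; exact hr0 (by simpa using hy)
      exact hns2 ⟨w / y, by field_simp; linear_combination hw - 2 * hy⟩
    have hχ : quadraticChar (ZMod p) (i * r) = 1 := by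
      rw [map_mul, (quadraticChar_neg_one_iff_not_isSquare).mpr hnsi, (quadraticChar_neg_one_iff_not_isSquare).mpr hnsr]; norm_num
    have hi0 : i ≠ 0 := by rintro rfl; norm_num at hi
    obtain ⟨x, hx⟩ := (quadraticChar_one_iff_isSquare (mul_ne_zero hi0 hr0)).mp hχ
    exact hα ⟨x, by rw [show x ^ 4 = (x * x) ^ 2 by ring, ← hx, mul_pow, hi, hr]; ring⟩
  refine ⟨fun hX ↦ ?_, fun hX ↦ ?_⟩
  · -- `Q₅`: `r = (7X² + 21)/8`, `2r = ((3 − 7X²)/(8X))²`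
    have hX0 : X ≠ 0 := by rintro rfl; norm_num at hX
    refine key ((7 * X ^ 2 + 21) / 8) ?_ ⟨(3 - 7 * X ^ 2) / (8 * X), ?_⟩
    · rw [div_pow, div_eq_iff (pow_ne_zero 2 h8)]; linear_combination (7 : ZMod p) * hX
    · have hD : 8 * X ≠ 0 := mul_ne_zero h8 hX0
      field_simp
      linear_combination (9 : ZMod p) * hX
  · -- `Q₆`: `r = (X² − 21)/8 = 2·(8X/(X² + 3))²`
    have h128 : (128 : ZMod p) ≠ 0 := by rw [show (128 : ZMod p) = 2 ^ 7 by norm_num]; exact pow_ne_zero 7 h2F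
    have hD : X ^ 2 + 3 ≠ 0 := by
      intro h; apply h128; linear_combination hX - (X ^ 2 - 45) * h
    refine key ((X ^ 2 - 21) / 8) ?_ ⟨16 * X / (X ^ 2 + 3), ?_⟩
    · rw [div_pow, div_eq_iff (pow_ne_zero 2 h8)]; linear_combination hX
    · field_simp
      linear_combination (2 * (X ^ 2 + 27)) * hX

omit [Fact q.Prime] in
/-- **Class `−qp ∈ S′(A^{(−qp)})` dies at `p` (type α)**: `d = p·(−q)`, `d′ = p·(7q)`; a square root `T = X²` of `7qT² + 42qT − q` is a root of
`Q₅ = 7X⁴ + 42X² − 1`. [cite: SilvermanAEC2009, Prop. X.4.9 and Example X.4.10] [cite: CoatesLiTianZhai2015, §5] -/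
theorem not_isSoluble_padic_typeAlpha_oddClass_negQP_five (hp8 : p % 8 = 5) (hp7 : legendreSym p (-7) = 1) (hα : ¬ ∃ x : ZMod p, x ^ 4 = -7)
    (hq0 : ((q : ℤ) : ZMod p) ≠ 0)
    (h7q : ((7 * (q : ℤ) : ℤ) : ZMod p) ≠ 0) {d d' : ℤ} (hd : d = p * (-(q : ℤ))) (hd' : d' = p * (7 * (q : ℤ))) :
    ¬ ((twoIsogenyQuartic (42 * ((q : ℤ) * p)) d d').map (Int.castRingHom ℚ_[p])).IsSoluble := by
  refine not_isSoluble_padic_of_prime_dvd_coeffs_of_roots (p := p) (c := 42 * q) (e := -(q : ℤ)) (e' := 7 * q) (by ring) hd hd' h7q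
    (fun T hT ↦ ?_)
  rintro ⟨X, rfl⟩
  have h5 := (rootfree_Q5_Q6_of_alpha_five hp8 hp7 hα X).1
  apply h5
  have hq0' : (q : ZMod p) ≠ 0 := by exact_mod_cast hq0
  have e1 : ((7 * (q : ℤ) : ℤ) : ZMod p) * (X * X) ^ 2 + ((42 * q : ℤ) : ZMod p) * (X * X) + ((-(q : ℤ) : ℤ) : ZMod p) =
      (q : ZMod p) * (7 * X ^ 4 + 42 * X ^ 2 - 1) := by push_cast; ring
  rw [e1] at hT
  exact (mul_eq_zero.mp hT).resolve_left hq0'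

omit [Fact q.Prime] in
/-- **Class `7qp ∈ S′(A^{(−qp)})` dies at `p` (type α)**: `d = p·(7q)`, `d′ = p·(−q)`; a square root of `−qT² + 42qT + 7q` is a root of
`Q₆ = X⁴ − 42X² − 7`. [cite: SilvermanAEC2009, Prop. X.4.9 and Example X.4.10] [cite: CoatesLiTianZhai2015, §5] -/
theorem not_isSoluble_padic_typeAlpha_oddClass_sevenQP_five (hp8 : p % 8 = 5) (hp7 : legendreSym p (-7) = 1) (hα : ¬ ∃ x : ZMod p, x ^ 4 = -7)
    (hq0 : ((q : ℤ) : ZMod p) ≠ 0)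
    (hmq : ((-(q : ℤ) : ℤ) : ZMod p) ≠ 0) {d d' : ℤ} (hd : d = p * (7 * (q : ℤ))) (hd' : d' = p * (-(q : ℤ))) :
    ¬ ((twoIsogenyQuartic (42 * ((q : ℤ) * p)) d d').map (Int.castRingHom ℚ_[p])).IsSoluble := by
  refine not_isSoluble_padic_of_prime_dvd_coeffs_of_roots (p := p) (c := 42 * q) (e := 7 * (q : ℤ)) (e' := -(q : ℤ)) (by ring) hd hd' hmq
    (fun T hT ↦ ?_)
  rintro ⟨X, rfl⟩
  have h6 := (rootfree_Q5_Q6_of_alpha_five hp8 hp7 hα X).2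
  apply h6
  have hq0' : (q : ZMod p) ≠ 0 := by exact_mod_cast hq0
  have e1 : ((-(q : ℤ) : ℤ) : ZMod p) * (X * X) ^ 2 + ((42 * q : ℤ) : ZMod p) * (X * X) + ((7 * (q : ℤ) : ℤ) : ZMod p) =
      -(q : ZMod p) * (X ^ 4 - 42 * X ^ 2 - 7) := by push_cast; ring
  rw [e1] at hT
  exact (mul_eq_zero.mp hT).resolve_left (neg_ne_zero.mpr hq0')

omit [Fact q.Prime] in
/-- **Class `p ∈ S′(A^{(−qp)})` dies at `p` on a75+ (type α, `(q/p) = +1`)**: `d = p·1`, `d′ = p·(−7q²)`; a square root `T = X²` of `−7q²T² + 42qT + 1`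
gives, with `r² = q`, `i² = −1`, the root `Z = irX` of `Q₅`. [cite: SilvermanAEC2009, Prop. X.4.9 and Example X.4.10] [cite: CoatesLiTianZhai2015, §5] -/
theorem not_isSoluble_padic_typeAlpha_oddClass_P_plus_five (hp8 : p % 8 = 5) (hp7 : legendreSym p (-7) = 1) (hα : ¬ ∃ x : ZMod p, x ^ 4 = -7)
    (hqsq : IsSquare ((q : ℤ) : ZMod p)) (him : IsSquare ((-1 : ℤ) : ZMod p)) (h7q2 : ((-7 * (q : ℤ) ^ 2 : ℤ) : ZMod p) ≠ 0)
    {d d' : ℤ} (hd : d = p * (1 : ℤ)) (hd' : d' = p * (-7 * (q : ℤ) ^ 2)) :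
    ¬ ((twoIsogenyQuartic (42 * ((q : ℤ) * p)) d d').map (Int.castRingHom ℚ_[p])).IsSoluble := by
  refine not_isSoluble_padic_of_prime_dvd_coeffs_of_roots (p := p) (c := 42 * q) (e := (1 : ℤ)) (e' := -7 * (q : ℤ) ^ 2) (by ring) hd hd'
    h7q2 (fun T hT ↦ ?_)
  rintro ⟨X, rfl⟩
  obtain ⟨r, hr⟩ := hqsq
  obtain ⟨i, hi⟩ := him
  push_cast at hr hi hT
  have h5 := (rootfree_Q5_Q6_of_alpha_five hp8 hp7 hα (i * r * X)).1
  apply h5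
  linear_combination (-1 : ZMod p) * hT + (-7 * X ^ 4 * (r * r + (q : ZMod p)) + 42 * X ^ 2) * hr
    + (7 * X ^ 4 * (2 + (-1 - i * i)) * r ^ 4 - 42 * X ^ 2 * r ^ 2) * hi

omit [Fact q.Prime] in
/-- **Class `−7p ∈ S′(A^{(−qp)})` dies at `p` on a75+**: `d = p·(−7)`, `d′ = p·q²`; a square root of `q²T² + 42qT − 7` gives the root `Z = irX` of `Q₆`.
[cite: SilvermanAEC2009, Prop. X.4.9 and Example X.4.10] [cite: CoatesLiTianZhai2015, §5] -/
theorem not_isSoluble_padic_typeAlpha_oddClass_negSevenP_plus_five (hp8 : p % 8 = 5) (hp7 : legendreSym p (-7) = 1) (hα : ¬ ∃ x : ZMod p, x ^ 4 = -7)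
    (hqsq : IsSquare ((q : ℤ) : ZMod p)) (him : IsSquare ((-1 : ℤ) : ZMod p)) (hq2 : (((q : ℤ) ^ 2 : ℤ) : ZMod p) ≠ 0)
    {d d' : ℤ} (hd : d = p * (-7 : ℤ)) (hd' : d' = p * ((q : ℤ) ^ 2)) :
    ¬ ((twoIsogenyQuartic (42 * ((q : ℤ) * p)) d d').map (Int.castRingHom ℚ_[p])).IsSoluble := by
  refine not_isSoluble_padic_of_prime_dvd_coeffs_of_roots (p := p) (c := 42 * q) (e := (-7 : ℤ)) (e' := (q : ℤ) ^ 2) (by ring) hd hd'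
    hq2 (fun T hT ↦ ?_)
  rintro ⟨X, rfl⟩
  obtain ⟨r, hr⟩ := hqsq
  obtain ⟨i, hi⟩ := him
  push_cast at hr hi hT
  have h6 := (rootfree_Q5_Q6_of_alpha_five hp8 hp7 hα (i * r * X)).2
  apply h6
  linear_combination hT + (-(X ^ 4) * (r * r + (q : ZMod p)) - 42 * X ^ 2) * hr
    + (X ^ 4 * (2 + (-1 - i * i)) * r ^ 4 + 42 * X ^ 2 * r ^ 2) * hi

/-! ## §2 `S′ = S(42qp, −7q²p²) ⊆ {1, −7, −q, 7q}` on a75+ -/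

set_option maxHeartbeats 400000 in -- sixteen classes
/-- **`S′ = S(42qp, −7q²p²) ⊆ {1, −7, −q, 7q}`** on a75+: `{−1, q, −p, qp}`, `{7, −7q, 7p, −7qp}` die at `7`, the `p`-coset `{p, −7p, −qp, 7qp}` at `p`
(type α at `p ≡ 5 (8)`), `−q, 7q` survive. [cite: SilvermanAEC2009, Prop. X.4.9 and Example X.4.10] [cite: Zywina2025, Lemma 3.1 (proof)] -/
theorem twoIsogenySelmerGroup'_oddTwoPrimesTwist_subset_plusPFiveAlpha (hq8 : q % 8 = 7) (hq7 : jacobiSym q 7 = -1) (hp8 : p % 8 = 5)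
    (hp7 : legendreSym p (-7) = 1) (hα : ¬ ∃ x : ZMod p, x ^ 4 = -7) (hpq : jacobiSym p q = 1) :
    twoIsogenySelmerGroup' (-21 * ((q : ℤ) * p)) (112 * ((q : ℤ) * p) ^ 2) ⊆ ({1, -7, -(q : ℤ), 7 * (q : ℤ)} : Finset ℤ) := by
  have hq : q.Prime := Fact.out
  have hp : p.Prime := Fact.out
  haveI : Fact (Nat.Prime 7) := ⟨by norm_num⟩
  have hqZ : Prime (q : ℤ) := Nat.prime_iff_prime_int.mp hq
  have hpZ : Prime (p : ℤ) := Nat.prime_iff_prime_int.mp hp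
  have hq0 : (q : ℤ) ≠ 0 := by exact_mod_cast hq.ne_zero
  have hp0 : (p : ℤ) ≠ 0 := by exact_mod_cast hp.ne_zero
  obtain ⟨⟨hq2, hp2, hqp, h7qp, h7Q, h7P⟩, ⟨h7_q, h7_p, hq07, hp07⟩, ⟨h2p, h7p, hm1p, hqp_p⟩, ⟨hqp0, hpq0⟩⟩ :=
    oddTwoPrimes_facts_plusPFive hq8 hq7 hp8 hp7 hpq
  -- squares mod `p`: `q`, `−1`; non-vanishings
  have hqsq : IsSquare ((q : ℤ) : ZMod p) := (legendreSym.eq_one_iff p hqp0).mp hqp_p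
  have him : IsSquare ((-1 : ℤ) : ZMod p) :=
    (legendreSym.eq_one_iff p (by rw [Int.cast_neg, Int.cast_one]; exact neg_ne_zero.mpr one_ne_zero)).mp hm1p
  have h7p0 : ((7 : ℤ) : ZMod p) ≠ 0 := by
    have hp7' : p ≠ 7 := by rintro rfl; norm_num at hp8
    rw [Ne, ZMod.intCast_zmod_eq_zero_iff_dvd]
    intro h
    exact hp7' ((Nat.prime_dvd_prime_iff_eq hp (by norm_num)).mp (by exact_mod_cast h))
  have h7q0 : ((7 * (q : ℤ) : ℤ) : ZMod p) ≠ 0 := by push_cast; exact mul_ne_zero (by exact_mod_cast h7p0) (by exact_mod_cast hqp0)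
  have hmq0 : ((-(q : ℤ) : ℤ) : ZMod p) ≠ 0 := by push_cast; exact neg_ne_zero.mpr (by exact_mod_cast hqp0)
  have h7q2 : ((-7 * (q : ℤ) ^ 2 : ℤ) : ZMod p) ≠ 0 := by
    push_cast; exact mul_ne_zero (neg_ne_zero.mpr (by exact_mod_cast h7p0)) (pow_ne_zero 2 (by exact_mod_cast hqp0))
  have hq20 : (((q : ℤ) ^ 2 : ℤ) : ZMod p) ≠ 0 := by push_cast; exact pow_ne_zero 2 (by exact_mod_cast hqp0)
  have hA : (-2 * (-21 * ((q : ℤ) * p))) = 42 * ((q : ℤ) * p) := by ring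
  have hB : ((-21 * ((q : ℤ) * p)) ^ 2 - 4 * (112 * ((q : ℤ) * p) ^ 2)) = -7 * ((q : ℤ) * p) ^ 2 := by ring
  have hb : (-7 * ((q : ℤ) * p) ^ 2 : ℤ) ≠ 0 := mul_ne_zero (by norm_num) (pow_ne_zero 2 (mul_ne_zero hq0 hp0))
  intro d hd
  rw [twoIsogenySelmerGroup'_eq, hA, hB, mem_twoIsogenySelmerGroup_iff hb] at hd
  obtain ⟨hsqf, ⟨d', hdd'⟩, hloc⟩ := hd
  have hd'eq : (-7 * ((q : ℤ) * p) ^ 2 : ℤ) / d = d' := by rw [hdd', Int.mul_ediv_cancel_left _ hsqf.ne_zero]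
  rw [hd'eq] at hloc
  obtain ⟨-, hpadic⟩ := hloc
  -- `d ∣ 7qp`
  have h0 : d ∣ -7 * ((q : ℤ) * p) ^ 2 := ⟨d', hdd'⟩
  have h1 : d ∣ (7 * ((q : ℤ) * p)) ^ 2 := h0.trans ⟨-7, by ring⟩
  have h7qp' : d ∣ 7 * ((q : ℤ) * p) := (hsqf.dvd_pow_iff_dvd (by norm_num)).mp h1
  have hQP7 : ∀ n : ℤ, ¬ (7 : ℤ) ∣ n → ¬ (7 : ℤ) ∣ n * ((q : ℤ) * p) ^ 2 := fun n hn ↦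
    not_seven_dvd_mul_oddTwoPrimes hn (by rw [sq]; exact not_seven_dvd_mul_oddTwoPrimes (not_seven_dvd_mul_oddTwoPrimes h7Q h7P) (not_seven_dvd_mul_oddTwoPrimes h7Q h7P))
  have hQP07 : ((((q : ℤ) * p : ℤ)) : ZMod 7) ≠ 0 := by push_cast at hq07 hp07 ⊢; exact mul_ne_zero hq07 hp07
  simp only [Finset.mem_insert, Finset.mem_singleton]
  by_cases hqd : (q : ℤ) ∣ d
  · obtain ⟨e, rfl⟩ := hqd
    have he7p : e ∣ 7 * (p : ℤ) := by
      have : (q : ℤ) * e ∣ (q : ℤ) * (7 * p) := by rw [show (q : ℤ) * (7 * p) = 7 * (q * p) by ring]; exact h7qp'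
      exact (mul_dvd_mul_iff_left hq0).mp this
    have hd'e : e * d' = -7 * (q : ℤ) * p ^ 2 := mul_left_cancel₀ hq0 (by linear_combination (-1 : ℤ) * hdd')
    by_cases hpe : (p : ℤ) ∣ e
    · -- `d = qp·e₂`, `e₂ ∣ 7`: `qp`, `−7qp` die at `7`; `−qp`, `7qp` at `p` (type α)
      exfalso
      obtain ⟨e₂, rfl⟩ := hpe
      have he7 : e₂ ∣ 7 := by
        have : (p : ℤ) * e₂ ∣ (p : ℤ) * 7 := by rw [mul_comm (p : ℤ) 7]; exact he7p
        exact (mul_dvd_mul_iff_left hp0).mp this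
      have hd'e₂ : e₂ * d' = -7 * (q : ℤ) * p := mul_left_cancel₀ hp0 (by linear_combination hd'e)
      have hle : e₂ ≤ 7 := Int.le_of_dvd (by norm_num) he7
      have hge : -7 ≤ e₂ := by have := Int.le_of_dvd (by norm_num) ((Int.neg_dvd).mpr he7); linarith
      have hne1 : e₂ ≠ 1 := by
        rintro rfl
        refine not_isSoluble_seven_odd h7qp hdd'.symm
          (by rw [show (q : ℤ) * ((p : ℤ) * 1) = q * p by ring]; exact not_seven_dvd_mul_oddTwoPrimes h7Q h7P) ?_ (hpadic 7)
        rw [show (q : ℤ) * ((p : ℤ) * 1) = q * p by ring, legendreSym.mul, h7_q, h7_p]; norm_num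
      have hnem7 : e₂ ≠ -7 := by
        rintro rfl
        have hd'1 : d' = (q : ℤ) * p := mul_left_cancel₀ (by norm_num : (-7 : ℤ) ≠ 0) (by linear_combination hd'e₂)
        refine not_isSoluble_seven_odd' h7qp hdd'.symm (by rw [hd'1]; exact not_seven_dvd_mul_oddTwoPrimes h7Q h7P) ?_ (hpadic 7)
        rw [hd'1, legendreSym.mul, h7_q, h7_p]; norm_num
      have hnem1 : e₂ ≠ -1 := by
        rintro rfl
        exact not_isSoluble_padic_typeAlpha_oddClass_negQP_five (q := q) hp8 hp7 hα hqp0 h7q0 (by ring)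
          (by linear_combination (-1 : ℤ) * hd'e₂) (hpadic p)
      have hne7 : e₂ ≠ 7 := by
        rintro rfl
        exact not_isSoluble_padic_typeAlpha_oddClass_sevenQP_five (q := q) hp8 hp7 hα hqp0 hmq0 (by ring)
          (mul_left_cancel₀ (by norm_num : (7 : ℤ) ≠ 0) (by linear_combination hd'e₂)) (hpadic p)
      obtain ⟨k, hk⟩ := he7
      interval_cases e₂ <;> omega
    · -- `d = q·e`, `e ∣ 7`: `q`, `−7q` die at `7`; `−q`, `7q` SURVIVE
      have hcop : IsCoprime e (p : ℤ) := ((hpZ.irreducible.coprime_iff_not_dvd).mpr hpe).symm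
      have he7 : e ∣ 7 := hcop.dvd_of_dvd_mul_right he7p
      have hle : e ≤ 7 := Int.le_of_dvd (by norm_num) he7
      have hge : -7 ≤ e := by have := Int.le_of_dvd (by norm_num) ((Int.neg_dvd).mpr he7); linarith
      have hne1 : e ≠ 1 := by
        rintro rfl
        refine not_isSoluble_seven_odd h7qp hdd'.symm (by rw [mul_one]; exact h7Q) ?_ (hpadic 7)
        rw [mul_one, h7_q]
      have hnem7 : e ≠ -7 := by
        rintro rfl
        have hd'1 : d' = (q : ℤ) * p ^ 2 := mul_left_cancel₀ (by norm_num : (-7 : ℤ) ≠ 0) (by linear_combination hd'e)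
        refine not_isSoluble_seven_odd' h7qp hdd'.symm ?_ ?_ (hpadic 7)
        · rw [hd'1]; exact not_seven_dvd_mul_oddTwoPrimes h7Q (by rw [sq]; exact not_seven_dvd_mul_oddTwoPrimes h7P h7P)
        · rw [hd'1, legendreSym.mul, legendreSym.sq_one' 7 hp07, h7_q]; norm_num
      obtain ⟨k, hk⟩ := he7
      have hcases : e = -1 ∨ e = 7 := by interval_cases e <;> omega
      rcases hcases with rfl | rfl
      · right; right; left; ring
      · right; right; right; ring
  · have hcop : IsCoprime d (q : ℤ) := ((hqZ.irreducible.coprime_iff_not_dvd).mpr hqd).symm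
    have hd7p : d ∣ 7 * (p : ℤ) := hcop.dvd_of_dvd_mul_right (by rw [show 7 * (p : ℤ) * q = 7 * (q * p) by ring]; exact h7qp')
    by_cases hpd : (p : ℤ) ∣ d
    · -- `d = p·e`, `e ∣ 7`: `−p`, `7p` die at `7`; `p`, `−7p` at `p` (type α, `Z = irX`)
      exfalso
      obtain ⟨e, rfl⟩ := hpd
      have he7 : e ∣ 7 := by
        have : (p : ℤ) * e ∣ (p : ℤ) * 7 := by rw [mul_comm (p : ℤ) 7]; exact hd7p
        exact (mul_dvd_mul_iff_left hp0).mp this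
      have hd'e : e * d' = -7 * (q : ℤ) ^ 2 * p := mul_left_cancel₀ hp0 (by linear_combination (-1 : ℤ) * hdd')
      have hle : e ≤ 7 := Int.le_of_dvd (by norm_num) he7
      have hge : -7 ≤ e := by have := Int.le_of_dvd (by norm_num) ((Int.neg_dvd).mpr he7); linarith
      have hnem1 : e ≠ -1 := by
        rintro rfl
        refine not_isSoluble_seven_odd h7qp hdd'.symm (by rw [mul_neg_one, Int.dvd_neg]; exact h7P) ?_ (hpadic 7)
        rw [legendreSym.mul, h7_p]; norm_num
      have hne7 : e ≠ 7 := by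
        rintro rfl
        have hd'1 : d' = (q : ℤ) ^ 2 * (p * -1) := mul_left_cancel₀ (by norm_num : (7 : ℤ) ≠ 0) (by linear_combination hd'e)
        refine not_isSoluble_seven_odd' h7qp hdd'.symm ?_ ?_ (hpadic 7)
        · rw [hd'1]; exact not_seven_dvd_mul_oddTwoPrimes (by rw [sq]; exact not_seven_dvd_mul_oddTwoPrimes h7Q h7Q)
            (by rw [mul_neg_one, Int.dvd_neg]; exact h7P)
        · rw [hd'1, legendreSym.mul, legendreSym.mul, legendreSym.sq_one' 7 hq07, h7_p]; norm_num
      have hne1 : e ≠ 1 := by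
        rintro rfl
        exact not_isSoluble_padic_typeAlpha_oddClass_P_plus_five (q := q) hp8 hp7 hα hqsq him h7q2 (by ring)
          (by linear_combination hd'e) (hpadic p)
      have hnem7 : e ≠ -7 := by
        rintro rfl
        exact not_isSoluble_padic_typeAlpha_oddClass_negSevenP_plus_five (q := q) hp8 hp7 hα hqsq him hq20 (by ring)
          (mul_left_cancel₀ (by norm_num : (-7 : ℤ) ≠ 0) (by linear_combination hd'e)) (hpadic p)
      obtain ⟨k, hk⟩ := he7
      interval_cases e <;> omega
    · -- `d ∣ 7`: `−1`, `7` die at `7`; `1`, `−7` survive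
      have hcopp : IsCoprime d (p : ℤ) := ((hpZ.irreducible.coprime_iff_not_dvd).mpr hpd).symm
      have hd7 : d ∣ 7 := hcopp.dvd_of_dvd_mul_right hd7p
      have hle : d ≤ 7 := Int.le_of_dvd (by norm_num) hd7
      have hge : -7 ≤ d := by have := Int.le_of_dvd (by norm_num) ((Int.neg_dvd).mpr hd7); linarith
      have hnm1 : d ≠ -1 := by
        rintro rfl; exact not_isSoluble_seven_odd h7qp hdd'.symm (by decide) (by norm_num) (hpadic 7)
      have hn7 : d ≠ 7 := by
        rintro rfl
        have hd'1 : d' = -1 * ((q : ℤ) * p) ^ 2 := by linarith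
        refine not_isSoluble_seven_odd' h7qp hdd'.symm (by rw [hd'1]; exact hQP7 (-1) (by decide)) ?_ (hpadic 7)
        rw [hd'1, legendreSym.mul, legendreSym.sq_one' 7 hQP07]; norm_num
      obtain ⟨k, hk⟩ := hd7
      have hcases : d = 1 ∨ d = -7 := by interval_cases d <;> omega
      rcases hcases with rfl | rfl
      · left; rfl
      · right; left; rfl

/-- **`#S′ = #S(42qp, −7q²p²) ≤ 4`** on a75+ (sharp). [cite: SilvermanAEC2009, Prop. X.4.9] -/
theorem card_twoIsogenySelmerGroup'_oddTwoPrimesTwist_le_four_plusPFiveAlpha (hq8 : q % 8 = 7) (hq7 : jacobiSym q 7 = -1) (hp8 : p % 8 = 5)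
    (hp7 : legendreSym p (-7) = 1) (hα : ¬ ∃ x : ZMod p, x ^ 4 = -7) (hpq : jacobiSym p q = 1) :
    (twoIsogenySelmerGroup' (-21 * ((q : ℤ) * p)) (112 * ((q : ℤ) * p) ^ 2)).card ≤ 4 :=
  (Finset.card_le_card (twoIsogenySelmerGroup'_oddTwoPrimesTwist_subset_plusPFiveAlpha hq8 hq7 hp8 hp7 hα hpq)).trans Finset.card_le_four

end OddSelmerDualPlusPFive

end Summit.BirchSwinnertonDyer.BirchSwinnertonDyer.Theorems.GoldfeldGoodTwists

end
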